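import Literature.MathematicalPhysics.QuantumLattice.HubbardModelParticleHoleProofs
import Literature.MathematicalPhysics.QuantumLattice.FinDimSpectrumSectorGibbsLimit
import Literature.MathematicalPhysics.QuantumLattice.HubbardWave0LiebProofs
import HarnessLib

/-!
# Particle–hole conjugation of joint-sector ground states (bipartite Hubbard model)

Obstruction report, Theorem 20, part (a) (session 13): the sector-level form of Lieb's
particle–hole symmetry, needed for the hole/electron-doping equivalence of the summit
(`SoloBlindParticleHoleSymmetry`). For a bipartite sign `ε` (`ε_x = -ε_y` on edges) and the full
particle–hole unitary `P : c_{xσ} ↦ ε_x c†_{xσ}` (`particleHole`; the tree has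
`P H(t,U) Pᴴ = H(t,U) - UN + U|Λ|`, `hamiltonian_particleHole_bipartite`):

* `particleHole_mul_spinZ_mul_conjTranspose` — `P S^z Pᴴ = -S^z`;
* `conjTranspose_mulVec_mem_szSector` — `Pᴴ` maps the joint sector `(N, S^z = M)` into
  `(2|Λ| - N, -M)`, isometrically (`star_conjTranspose_mulVec_dotProduct`);
* `hamiltonian_mulVec_conjTranspose_mulVec`, `re_rayleigh_conjTranspose_mulVec` —
  `H Pᴴψ = Pᴴ Hψ + U(|Λ| - N) Pᴴψ` on `N`-particle vectors;
* `minEnergyOn_szSector_particleHole` — `λ_min(2|Λ| - N, -M) = λ_min(N, M) + U(|Λ| - N)`;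
* `isGroundStateInSector_conjTranspose_mulVec` — **unit ground states of the sector `(N, M)` are
  carried to unit ground states of `(2|Λ| - N, -M)`**.

Elementary and essentially in Lieb, PRL 62 (1989) 1201 and Lieb–Wu, Physica A 321 (2003) 1, §1
eq. (3) (stated there for energies); recorded here at the level of the tree's
`IsGroundStateInSector`. [folklore]
-/

noncomputable section
noncomputable section

namespace Summit.HubbardSuperconductivity.HubbardSuperconductivity.Theorems

open Matrix Finset Literature.Probability.LatticeModels Literature.MathematicalPhysics.QuantumLattice
  HubbardWave0
open scoped ComplexOrder ComplexConjugate Matrix.Norms.L2Operator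

namespace ParticleHole

-- see `SoloBlindPairFieldLocality`: make instance synthesis agree with the landed terms
-- (`DecidableEq` on `Lex` types through the linear order, not Mathlib's `instDecidableEqLex`),
-- file-locally; no instance is added.
attribute [-instance] instDecidableEqLex

/-! ### Unimodular particle–hole maps: norm, spin, sectors -/

section General

variable {Λ : Type*} [LinearOrder Λ] [Fintype Λ]

/-- `⟨Pᴴψ, Pᴴφ⟩ = ⟨ψ, φ⟩` (`P Pᴴ = 1`). Tasaki (2020) §9.3.3. [folklore] -/
theorem star_conjTranspose_mulVec_dotProduct (ε : Orb Λ → ℂ) (hε : ∀ i, ‖ε i‖ = 1)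
    (ψ φ : Fock (Orb Λ)) :
    star ((particleHole ε)ᴴ *ᵥ ψ) ⬝ᵥ ((particleHole ε)ᴴ *ᵥ φ) = star ψ ⬝ᵥ φ := by
  rw [star_mulVec, conjTranspose_conjTranspose, ← dotProduct_mulVec, mulVec_mulVec,
    particleHole_mul_conjTranspose ε hε, one_mulVec]

/-- **`P S^z Pᴴ = -S^z`** for unimodular phases. Lieb, PRL 62 (1989) 1201. [folklore] -/
theorem particleHole_mul_spinZ_mul_conjTranspose (ε : Orb Λ → ℂ) (hε : ∀ i, ‖ε i‖ = 1) :
    particleHole ε * HubbardWave0.spinZ * (particleHole ε)ᴴ =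
      -(HubbardWave0.spinZ : Matrix (Finset (Orb Λ)) (Finset (Orb Λ)) ℂ) := by
  have hnum : ∀ (x : Λ) (σ : Fin 2),
      particleHole ε * numberOp x σ * (particleHole ε)ᴴ = 1 - numberOp x σ := by
    intro x σ
    have h := particleHole_mul_numberAt_mul_conjTranspose_holds ε hε (orb x σ)
    simpa using h
  have h1 : ∀ x : Λ, particleHole ε * (numberOp x 0 - numberOp x 1) * (particleHole ε)ᴴ =
      -(numberOp x 0 - numberOp x 1) := by
    intro x
    rw [Matrix.mul_sub, Matrix.sub_mul, hnum, hnum]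
    abel
  unfold HubbardWave0.spinZ
  rw [Matrix.mul_smul, Matrix.smul_mul, Finset.mul_sum, Finset.sum_mul]
  simp only [h1, Finset.sum_neg_distrib, smul_neg]

/-- **`Pᴴ` maps the joint sector `(N, S^z = M)` into `(2|Λ| - N, S^z = -M)`.**
Lieb, PRL 62 (1989) 1201; Lieb–Wu, Physica A 321 (2003) 1, §1 eq. (3). [folklore] -/
theorem conjTranspose_mulVec_mem_szSector (ε : Orb Λ → ℂ) (hε : ∀ i, ‖ε i‖ = 1) {N : ℕ} {M : ℝ}
    {ψ : Fock (Orb Λ)} (hψ : ψ ∈ szSector N M) :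
    (particleHole ε)ᴴ *ᵥ ψ ∈ szSector (2 * Fintype.card Λ - N) (-M) := by
  rw [mem_szSector_iff] at hψ ⊢
  obtain ⟨hN, hS⟩ := hψ
  refine ⟨?_, ?_⟩
  · intro s hs
    rw [particleHole_conjTranspose_mulVec_apply]
    have hc : sᶜ.card ≠ N := by
      rw [Finset.card_compl, card_orb]
      have := s.card_le_univ
      rw [card_orb] at this
      omega
    rw [hN _ hc, mul_zero]
  · have hP := particleHole_mul_spinZ_mul_conjTranspose ε hε
    have hcomm : HubbardWave0.spinZ * (particleHole ε)ᴴ =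
        -((particleHole ε)ᴴ * HubbardWave0.spinZ) := by
      calc HubbardWave0.spinZ * (particleHole ε)ᴴ
          = (particleHole ε)ᴴ * (particleHole ε * HubbardWave0.spinZ * (particleHole ε)ᴴ) := by
            rw [← Matrix.mul_assoc, ← Matrix.mul_assoc, particleHole_conjTranspose_mul ε hε,
              Matrix.one_mul]
        _ = -((particleHole ε)ᴴ * HubbardWave0.spinZ) := by rw [hP, Matrix.mul_neg]
    rw [mulVec_mulVec, hcomm, Matrix.neg_mulVec, ← mulVec_mulVec, hS, mulVec_smul,
      Complex.ofReal_neg, neg_smul]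

variable (G : SimpleGraph Λ) [DecidableRel G.Adj]

/-- **The Hamiltonian on particle–hole conjugates** (bipartite sign `ε`): for an `N`-particle `ψ`,
`H (Pᴴψ) = Pᴴ (Hψ) + U(|Λ| - N) Pᴴψ`. Lieb, PRL 62 (1989) 1201. [folklore] -/
theorem hamiltonian_mulVec_conjTranspose_mulVec (ε : Λ → ℤˣ) (hε : ∀ x y, G.Adj x y → ε x = -ε y)
    (t U : ℝ) {N : ℕ} {ψ : Fock (Orb Λ)} (hψ : IsNParticle N ψ) :
    hamiltonian G t U *ᵥ ((particleHole (fun i : Orb Λ => ((ε (ofLex i).1 : ℤ) : ℂ)))ᴴ *ᵥ ψ) =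
      (particleHole (fun i : Orb Λ => ((ε (ofLex i).1 : ℤ) : ℂ)))ᴴ *ᵥ (hamiltonian G t U *ᵥ ψ) +
        ((U * ((Fintype.card Λ : ℝ) - N) : ℝ) : ℂ) •
          ((particleHole (fun i : Orb Λ => ((ε (ofLex i).1 : ℤ) : ℂ)))ᴴ *ᵥ ψ) := by
  set ε' : Orb Λ → ℂ := fun i => ((ε (ofLex i).1 : ℤ) : ℂ) with hε'
  have hn : ∀ i, ‖ε' i‖ = 1 := fun i => norm_intCast_units _
  set P := particleHole ε' with hP
  have hconj : P * hamiltonian G t U * Pᴴ =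
      hamiltonian G t U - (U : ℂ) • totalNumber + ((U * Fintype.card Λ : ℝ) : ℂ) • 1 :=
    hamiltonian_particleHole_bipartite_holds G t U ε hε
  have hHP : hamiltonian G t U * Pᴴ =
      Pᴴ * (hamiltonian G t U - (U : ℂ) • totalNumber + ((U * Fintype.card Λ : ℝ) : ℂ) • 1) := by
    rw [← hconj, ← Matrix.mul_assoc, ← Matrix.mul_assoc, particleHole_conjTranspose_mul ε' hn,
      Matrix.one_mul]
  rw [mulVec_mulVec, hHP, ← mulVec_mulVec, add_mulVec, sub_mulVec, smul_mulVec, smul_mulVec,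
    one_mulVec, totalNumber_mulVec_of_isNParticle hψ, mulVec_add, mulVec_sub, mulVec_smul,
    mulVec_smul, mulVec_smul, smul_smul]
  have hc : ((U * ((Fintype.card Λ : ℝ) - N) : ℝ) : ℂ) =
      ((U * Fintype.card Λ : ℝ) : ℂ) - (U : ℂ) * (N : ℂ) := by
    push_cast; ring
  rw [hc, sub_smul]
  abel

/-- Rayleigh quotients shift by `U(|Λ| - N)` under `Pᴴ` (bipartite sign). Lieb–Wu, Physica A 321
(2003) 1, §1 eq. (3). [folklore] -/
theorem re_rayleigh_conjTranspose_mulVec (ε : Λ → ℤˣ) (hε : ∀ x y, G.Adj x y → ε x = -ε y)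
    (t U : ℝ) {N : ℕ} {ψ : Fock (Orb Λ)} (hψ : IsNParticle N ψ) (h1 : star ψ ⬝ᵥ ψ = 1) :
    (star ((particleHole (fun i : Orb Λ => ((ε (ofLex i).1 : ℤ) : ℂ)))ᴴ *ᵥ ψ) ⬝ᵥ
        hamiltonian G t U *ᵥ ((particleHole (fun i : Orb Λ => ((ε (ofLex i).1 : ℤ) : ℂ)))ᴴ *ᵥ ψ)).re =
      (star ψ ⬝ᵥ hamiltonian G t U *ᵥ ψ).re + U * ((Fintype.card Λ : ℝ) - N) := by
  have hn : ∀ i : Orb Λ, ‖((ε (ofLex i).1 : ℤ) : ℂ)‖ = 1 := fun i => norm_intCast_units _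
  rw [hamiltonian_mulVec_conjTranspose_mulVec G ε hε t U hψ, dotProduct_add, dotProduct_smul,
    star_conjTranspose_mulVec_dotProduct _ hn, star_conjTranspose_mulVec_dotProduct _ hn, h1,
    smul_eq_mul, mul_one, Complex.add_re, Complex.ofReal_re]

/-- **Sector energies under particle–hole conjugation**:
`λ_min(2|Λ| - N, -M) = λ_min(N, M) + U(|Λ| - N)` whenever the sector `(N, M)` contains a unit vector
(`N ≤ 2|Λ|`). Lieb–Wu, Physica A 321 (2003) 1, §1 eq. (3). [folklore] -/
theorem minEnergyOn_szSector_particleHole (ε : Λ → ℤˣ) (hε : ∀ x y, G.Adj x y → ε x = -ε y)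
    (t U : ℝ) {N : ℕ} (hN : N ≤ 2 * Fintype.card Λ) (M : ℝ)
    (hne : ∃ φ ∈ szSector (Λ := Λ) N M, star φ ⬝ᵥ φ = 1) :
    (hamiltonian G t U).minEnergyOn (szSector (2 * Fintype.card Λ - N) (-M)) =
      (hamiltonian G t U).minEnergyOn (szSector N M) + U * ((Fintype.card Λ : ℝ) - N) := by
  have hn : ∀ i : Orb Λ, ‖((ε (ofLex i).1 : ℤ) : ℂ)‖ = 1 := fun i => norm_intCast_units _
  have hHh : (hamiltonian G t U).IsHermitian := LiebThm1.hamiltonian_isHermitian G t U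
  set S : Set ℝ := {E : ℝ | ∃ ψ ∈ szSector (Λ := Λ) N M,
      star ψ ⬝ᵥ ψ = 1 ∧ E = (star ψ ⬝ᵥ hamiltonian G t U *ᵥ ψ).re} with hS
  set S' : Set ℝ := {E : ℝ | ∃ ψ ∈ szSector (Λ := Λ) (2 * Fintype.card Λ - N) (-M),
      star ψ ⬝ᵥ ψ = 1 ∧ E = (star ψ ⬝ᵥ hamiltonian G t U *ᵥ ψ).re} with hS'
  have hset : S' = (OrderIso.addRight (U * ((Fintype.card Λ : ℝ) - N))) '' S := by
    ext E
    simp only [hS, hS', Set.mem_image, OrderIso.addRight_apply, Set.mem_setOf_eq]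
    constructor
    · rintro ⟨φ, hφ, h1, rfl⟩
      have hmem := conjTranspose_mulVec_mem_szSector (fun i : Orb Λ => ((ε (ofLex i).1 : ℤ) : ℂ))
        hn hφ
      rw [show 2 * Fintype.card Λ - (2 * Fintype.card Λ - N) = N by omega, neg_neg] at hmem
      have hφN : IsNParticle (2 * Fintype.card Λ - N) φ := ((mem_szSector_iff _ _ _).1 hφ).1
      refine ⟨(star ((particleHole (fun i : Orb Λ => ((ε (ofLex i).1 : ℤ) : ℂ)))ᴴ *ᵥ φ) ⬝ᵥ
          hamiltonian G t U *ᵥ ((particleHole (fun i : Orb Λ => ((ε (ofLex i).1 : ℤ) : ℂ)))ᴴ *ᵥ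
            φ)).re, ⟨_, hmem, by rw [star_conjTranspose_mulVec_dotProduct _ hn, h1], rfl⟩, ?_⟩
      rw [re_rayleigh_conjTranspose_mulVec G ε hε t U hφN h1, Nat.cast_sub hN]
      push_cast
      ring
    · rintro ⟨E, ⟨ψ, hψ, h1, rfl⟩, rfl⟩
      have hψN : IsNParticle N ψ := ((mem_szSector_iff _ _ _).1 hψ).1
      exact ⟨_, conjTranspose_mulVec_mem_szSector _ hn hψ,
        by rw [star_conjTranspose_mulVec_dotProduct _ hn, h1],
        by rw [re_rayleigh_conjTranspose_mulVec G ε hε t U hψN h1]⟩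
  have hSne : S.Nonempty := by
    obtain ⟨φ, hφ, h1⟩ := hne
    exact ⟨_, φ, hφ, h1, rfl⟩
  have hbdd : BddBelow S := by
    refine ⟨(hamiltonian G t U).groundEnergy, ?_⟩
    rintro E ⟨φ, -, h1, rfl⟩
    exact Matrix.groundEnergy_le_rayleigh_holds hHh φ h1
  unfold Matrix.minEnergyOn
  change sInf S' = sInf S + U * ((Fintype.card Λ : ℝ) - N)
  rw [hset, ← OrderIso.map_csInf' _ hSne hbdd, OrderIso.addRight_apply]

/-- **Ground states go to ground states**: if `ψ` is a unit ground state of the bipartite Hubbard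
Hamiltonian in the joint sector `(N, S^z = M)`, then `Pᴴψ` is a unit ground state in the sector
`(2|Λ| - N, S^z = -M)`. Lieb, PRL 62 (1989) 1201. [folklore] -/
theorem isGroundStateInSector_conjTranspose_mulVec (ε : Λ → ℤˣ) (hε : ∀ x y, G.Adj x y → ε x = -ε y)
    (t U : ℝ) {N : ℕ} (hN : N ≤ 2 * Fintype.card Λ) {M : ℝ} {ψ : Fock (Orb Λ)}
    (hψ : IsGroundStateInSector (hamiltonian G t U) N M ψ) (h1 : star ψ ⬝ᵥ ψ = 1) :
    IsGroundStateInSector (hamiltonian G t U) (2 * Fintype.card Λ - N) (-M)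
      ((particleHole (fun i : Orb Λ => ((ε (ofLex i).1 : ℤ) : ℂ)))ᴴ *ᵥ ψ) := by
  have hn : ∀ i : Orb Λ, ‖((ε (ofLex i).1 : ℤ) : ℂ)‖ = 1 := fun i => norm_intCast_units _
  obtain ⟨hmem, hne0, heig⟩ := hψ
  have hψN : IsNParticle N ψ := ((mem_szSector_iff _ _ _).1 hmem).1
  refine ⟨conjTranspose_mulVec_mem_szSector _ hn hmem, ?_, ?_⟩
  · intro h0
    have h := star_conjTranspose_mulVec_dotProduct _ hn ψ ψ
    rw [h0, h1, dotProduct_zero] at h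
    exact zero_ne_one h
  · rw [hamiltonian_mulVec_conjTranspose_mulVec G ε hε t U hψN, heig, mulVec_smul, ← add_smul,
      ← Complex.ofReal_add, minEnergyOn_szSector_particleHole G ε hε t U hN M ⟨ψ, hmem, h1⟩]

end General

end ParticleHole

end Summit.HubbardSuperconductivity.HubbardSuperconductivity.Theorems

end
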